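import Summits.HubbardSuperconductivity.HubbardSuperconductivity.Theorems.HyperoctahedralMottCompleteGraphAnchorSums

/-!
# Route `HyperoctahedralMott`, support `CompleteGraphAnchor` (item stmt-HubbardSuperconductivity-6677):
# the sum-of-squares (Casimir) identity

Helper file 3/6. For a Gutzwiller vector `ψ` on a finite site set `Λ` (`n = |Λ|`) on which
`N↑`, `N↓` act as scalars `Nup`, `Ndn`, the interchange Laplacian of the complete graph
`ℒ = ½ Σ_{x≠y} (1 - Sw x y)` (`Sw = siteSwap`, the graded site swap) satisfies

  `⟨ψ, ℒ ψ⟩ = c ‖ψ‖² + ‖P C↑† ψ‖² + ‖P C↓† ψ‖² + ‖S⁺ ψ‖²`,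
  `c = n N - 2 n + N - Nup·Ndn - Ndn`  (`N = Nup + Ndn`),

with `C_σ† = Σ_x c†_{xσ}` the zero-momentum creators, `P` the Gutzwiller projector and `S⁺` the
spin raising operator: the quadratic Casimir of `gl(1|2)` written as a sum of squares. Hence
`ℒ ≥ c` on the sector, with equality on highest-weight vectors. No definitions. [folklore; context:
Sarkar, J. Phys. A 24 (1991) 1137; Essler–Korepin, PRB 46 (1992) 9147]
-/

-- the mandated namespace `Summit.<Summit>.<Problem>.Theorems` repeats `HubbardSuperconductivity`
-- (single-problem summit, D-0017), which the `dupNamespace` linter flags on every declaration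
set_option linter.dupNamespace false

noncomputable section

namespace Summit.HubbardSuperconductivity.HubbardSuperconductivity.Theorems.HyperoctahedralMott.Anchor

open Matrix Finset Literature.MathematicalPhysics.QuantumLattice HubbardWave0
open scoped ComplexOrder

variable {Λ : Type*} [LinearOrder Λ] [Fintype Λ]

/-- **The sum-of-squares identity for the interchange Laplacian on the complete graph.** For a
Gutzwiller vector `ψ` on which `N↑ = Σ_x n_{x↑}` and `N↓ = Σ_x n_{x↓}` act as the scalars
`Nup`, `Ndn`, the quadratic form of `ℒ = ½ Σ_{x≠y} (1 - Sw x y)` is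
`⟨ψ, ℒ ψ⟩ = c ‖ψ‖² + ‖P C↑† ψ‖² + ‖P C↓† ψ‖² + ‖S⁺ ψ‖²` with
`c = n N - 2n + N - Nup·Ndn - Ndn` (`n = |Λ|`, `N = Nup + Ndn`), i.e. `ℒ ≥ c` on the sector
with equality exactly on vectors killed by `S⁺` and by the projected zero-momentum creators.
[folklore] -/
theorem lap_expect_eq {ψ : Fock (Orb Λ)} (hG : IsGutzwiller ψ) {Nup Ndn : ℕ}
    (hup : (∑ x : Λ, numberOp x 0) *ᵥ ψ = (Nup : ℂ) • ψ)
    (hdn : (∑ x : Λ, numberOp x 1) *ᵥ ψ = (Ndn : ℂ) • ψ) :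
    star ψ ⬝ᵥ (((1 / 2 : ℂ) • ∑ x : Λ, ∑ y : Λ,
        (if (⊤ : SimpleGraph Λ).Adj x y then (1 - siteSwap x y) else 0)) *ᵥ ψ) =
      ((Fintype.card Λ : ℂ) * (Nup + Ndn) - 2 * (Fintype.card Λ) + (Nup + Ndn) - Nup * Ndn - Ndn) *
          (star ψ ⬝ᵥ ψ) +
        star (gutzwillerProj *ᵥ ((∑ x : Λ, creation (orb x 0)) *ᵥ ψ)) ⬝ᵥ
          (gutzwillerProj *ᵥ ((∑ x : Λ, creation (orb x 0)) *ᵥ ψ)) +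
        star (gutzwillerProj *ᵥ ((∑ x : Λ, creation (orb x 1)) *ᵥ ψ)) ⬝ᵥ
          (gutzwillerProj *ᵥ ((∑ x : Λ, creation (orb x 1)) *ᵥ ψ)) +
        star (spinPlus *ᵥ ψ) ⬝ᵥ (spinPlus *ᵥ ψ) := by
  -- the per-pair pieces
  set g : Fin 2 → Λ → Λ → ℂ := fun σ x y =>
    star ψ ⬝ᵥ ((creation (orb x σ) * annihilation (orb y σ)) *ᵥ ψ) with hg
  set d : Λ → Λ → ℂ := fun x y => star ψ ⬝ᵥ ((numberOp x 0 * numberOp y 1) *ᵥ ψ) with hd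
  set f : Λ → Λ → ℂ := fun x y => star ψ ⬝ᵥ
    ((creation (orb y 0) * annihilation (orb x 0) * (creation (orb x 1) * annihilation (orb y 1))) *ᵥ ψ)
    with hf
  set sm : Λ → Λ → ℂ := fun x y => star ψ ⬝ᵥ
    ((creation (orb x 1) * annihilation (orb x 0) * (creation (orb y 0) * annihilation (orb y 1))) *ᵥ ψ)
    with hsm
  set Nx : Λ → ℂ := fun x => star ψ ⬝ᵥ ((numberOp x 0 + numberOp x 1) *ᵥ ψ) with hNx
  set nrm := star ψ ⬝ᵥ ψ with hnrm
  -- scalar facts on the sector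
  have hN0 : star ψ ⬝ᵥ ((∑ x : Λ, numberOp x 0) *ᵥ ψ) = Nup * nrm := by
    rw [hup, dotProduct_smul, smul_eq_mul]
  have hN1 : star ψ ⬝ᵥ ((∑ x : Λ, numberOp x 1) *ᵥ ψ) = Ndn * nrm := by
    rw [hdn, dotProduct_smul, smul_eq_mul]
  -- (1) the swap expectation per ordered edge
  have h1 : ∀ x y, x ≠ y → star ψ ⬝ᵥ ((1 - siteSwap x y) *ᵥ ψ) =
      (Nx x + Nx y) - ((g 0 x y + g 1 x y) + (g 0 y x + g 1 y x)) -
        ((d x y + f x y) + (d y x + f y x)) := by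
    intro x y hxy
    rw [sub_mulVec, one_mulVec, dotProduct_sub, expect_siteSwap hxy hG]
    have hT : star ψ ⬝ᵥ ((∑ σ : Fin 2, (creation (orb x σ) * annihilation (orb y σ) +
        creation (orb y σ) * annihilation (orb x σ))) *ᵥ ψ) =
        (g 0 x y + g 0 y x) + (g 1 x y + g 1 y x) := by
      rw [Fin.sum_univ_two, add_mulVec, add_mulVec, add_mulVec, dotProduct_add, dotProduct_add,
        dotProduct_add]
    have hconj : (annihilation (orb x 0) * annihilation (orb y 1) -
        annihilation (orb x 1) * annihilation (orb y 0))ᴴ =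
        creation (orb y 1) * creation (orb x 0) - creation (orb y 0) * creation (orb x 1) := by
      rw [conjTranspose_sub, conjTranspose_mul, conjTranspose_mul]; rfl
    have hB : star ψ ⬝ᵥ ((((annihilation (orb x 0) * annihilation (orb y 1) -
          annihilation (orb x 1) * annihilation (orb y 0))ᴴ *
        (annihilation (orb x 0) * annihilation (orb y 1) -
          annihilation (orb x 1) * annihilation (orb y 0))) *ᵥ ψ)) =
        d x y + d y x + f y x + f x y := by
      rw [hconj, SusyTJ.pairDensity_normal_form hxy, add_mulVec, add_mulVec, add_mulVec,
        dotProduct_add, dotProduct_add, dotProduct_add]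
      rfl
    rw [hT, hB]
    ring
  -- (2) the edge sum of the Laplacian
  have h2 : star ψ ⬝ᵥ (((1 / 2 : ℂ) • ∑ x : Λ, ∑ y : Λ,
      (if (⊤ : SimpleGraph Λ).Adj x y then (1 - siteSwap x y) else 0)) *ᵥ ψ) =
      (1 / 2 : ℂ) * ∑ x, ∑ y,
        (if (⊤ : SimpleGraph Λ).Adj x y then star ψ ⬝ᵥ ((1 - siteSwap x y) *ᵥ ψ) else 0) := by
    rw [smul_mulVec, dotProduct_smul, smul_eq_mul, sum_mulVec, dotProduct_sum]
    congr 1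
    refine Finset.sum_congr rfl fun x _ => ?_
    rw [sum_mulVec, dotProduct_sum]
    refine Finset.sum_congr rfl fun y _ => ?_
    split_ifs
    · rfl
    · rw [zero_mulVec, dotProduct_zero]
  rw [h2, sum_top_adj_congr h1]
  -- (3) split the edge sum into the three resummable pieces
  have h3 : (∑ x, ∑ y, if (⊤ : SimpleGraph Λ).Adj x y then
      (Nx x + Nx y) - ((g 0 x y + g 1 x y) + (g 0 y x + g 1 y x)) -
        ((d x y + f x y) + (d y x + f y x)) else 0) =
      (∑ x, ∑ y, if (⊤ : SimpleGraph Λ).Adj x y then Nx x + Nx y else 0) -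
      (∑ x, ∑ y, if (⊤ : SimpleGraph Λ).Adj x y then
        (g 0 x y + g 1 x y) + (g 0 y x + g 1 y x) else 0) -
      (∑ x, ∑ y, if (⊤ : SimpleGraph Λ).Adj x y then (d x y + f x y) + (d y x + f y x) else 0) := by
    rw [sum_top_adj_eq, sum_top_adj_eq, sum_top_adj_eq, sum_top_adj_eq]
    simp only [Finset.sum_sub_distrib]
    ring
  rw [h3, sum_top_adj_add_eq, sum_top_adj_add_swap (fun x y => g 0 x y + g 1 x y),
    sum_top_adj_add_swap (fun x y => d x y + f x y)]
  -- (4) evaluate the pieces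
  have hNx : (∑ x, Nx x) = (Nup + Ndn) * nrm := by
    have : ∀ x, Nx x = star ψ ⬝ᵥ (numberOp x 0 *ᵥ ψ) + star ψ ⬝ᵥ (numberOp x 1 *ᵥ ψ) := by
      intro x; rw [hNx]; dsimp only; rw [add_mulVec, dotProduct_add]
    rw [Finset.sum_congr rfl fun x _ => this x, Finset.sum_add_distrib, ← dotProduct_sum,
      ← dotProduct_sum, ← sum_mulVec, ← sum_mulVec, hN0, hN1]
    ring
  have hG01 : (∑ x, ∑ y, if (⊤ : SimpleGraph Λ).Adj x y then g 0 x y + g 1 x y else 0) =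
      2 * (Fintype.card Λ : ℂ) * nrm -
        star (gutzwillerProj *ᵥ ((∑ x : Λ, creation (orb x 0)) *ᵥ ψ)) ⬝ᵥ
          (gutzwillerProj *ᵥ ((∑ x : Λ, creation (orb x 0)) *ᵥ ψ)) -
        star (gutzwillerProj *ᵥ ((∑ x : Λ, creation (orb x 1)) *ᵥ ψ)) ⬝ᵥ
          (gutzwillerProj *ᵥ ((∑ x : Λ, creation (orb x 1)) *ᵥ ψ)) -
        2 * (Nup + Ndn) * nrm := by
    rw [sum_top_adj_eq]
    simp only [Finset.sum_add_distrib]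
    rw [hg]
    dsimp only
    rw [sum_sum_expect_hop hG (show (0 : Fin 2) ≠ 1 by decide),
      sum_sum_expect_hop hG (show (1 : Fin 2) ≠ 0 by decide), sum_expect_hop_diag, sum_expect_hop_diag,
      hN0, hN1]
    ring
  have hDF : (∑ x, ∑ y, if (⊤ : SimpleGraph Λ).Adj x y then d x y + f x y else 0) =
      Nup * Ndn * nrm - star (spinPlus *ᵥ ψ) ⬝ᵥ (spinPlus *ᵥ ψ) + Ndn * nrm := by
    have hf' : ∀ x y, x ≠ y → d x y + f x y = d x y - sm x y := by
      intro x y hxy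
      rw [hf, hsm]
      dsimp only
      rw [flipTerm_eq_neg hxy, neg_mulVec, dotProduct_neg, sub_eq_add_neg]
    rw [sum_top_adj_congr hf', sum_top_adj_eq]
    simp only [Finset.sum_sub_distrib]
    rw [hd, hsm]
    dsimp only
    rw [sum_sum_expect_numberOp_mul, ← spinPlus_normSq_eq_sum, hdn, mulVec_smul, hup, smul_smul,
      dotProduct_smul, smul_eq_mul]
    have hdiag1 : (∑ x : Λ, star ψ ⬝ᵥ ((numberOp x 0 * numberOp x 1) *ᵥ ψ)) = 0 :=
      Finset.sum_eq_zero fun x _ => by rw [doublon_mulVec_eq_zero hG x, dotProduct_zero]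
    have hdiag2 : (∑ x : Λ, star ψ ⬝ᵥ ((creation (orb x 1) * annihilation (orb x 0) *
        (creation (orb x 0) * annihilation (orb x 1))) *ᵥ ψ)) = Ndn * nrm := by
      have : ∀ x : Λ, star ψ ⬝ᵥ ((creation (orb x 1) * annihilation (orb x 0) *
          (creation (orb x 0) * annihilation (orb x 1))) *ᵥ ψ) = star ψ ⬝ᵥ (numberOp x 1 *ᵥ ψ) := by
        intro x
        rw [flipTerm_same, sub_mulVec, doublon_mulVec_eq_zero hG x, sub_zero]
      rw [Finset.sum_congr rfl fun x _ => this x, ← dotProduct_sum, ← sum_mulVec, hN1]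
    rw [hdiag1, hdiag2]
    ring
  rw [hNx, hG01, hDF]
  ring

end Summit.HubbardSuperconductivity.HubbardSuperconductivity.Theorems.HyperoctahedralMott.Anchor
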